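import Summits.RiemannHypothesis.RiemannHypothesis.Theorems.MotivicDoorFfDimTwo

/-!
# Motivic door, function-field side (C)(i), part 9b: THE PAIR `{2,3}` DECIDES AT DIMENSION 2 IFF `q ∈ {3, 4}`
(pub-rhdoor seat ff-1.  HONEST FRAMING: lottery ticket at the motivic door; RH probability negligible; consolation
prizes are real: a new semi-local Weil-positivity theorem, or a located gap in the Connes–Consani programme, plus the
ff-door theorem.  No claim about `ζ`; "RH(q,h)" is `|α| = √q` for the complex roots of ONE integer polynomial `h`.)

Part 9a put dimension `2` in closed form: honest data `x^4 + a x^3 + b x^2 + q a x + q^2`, RH ⟺ the box of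
[Maisner–Nart 2002, Lemma 2.1] (imported), `s_2 = a² - 2b`, `s_3 = -a³ + 3ab - 3qa`.  Here the lag pair `{2, 3}`
(one lag at the handover `g = 2`, one beyond it) is settled for EVERY `q ≥ 2` (PROVED, [folklore] algebra plus two
kernel-checked finite searches):

* §1 `sTwoThree_collision`: two honest quartics share `(s_2, s_3)` iff `(a', b') = (a, b)` or
  `(2a' + a)² = 9a² - 24b + 24q ∧ 2b' = a'² - a² + 2b` — the `(s_2, s_3)`-fibre through `(a, b)` has at most two
  further points, on a conic.
* §2 `traceReader_two_three_decides_of_check` + `sTwoThree_check_three/four` (`decide` in the kernel): for `q = 3`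
  and `q = 4` every such partner of an RH-true `(a, b)` is again in the box, so the reader "some RH-true honest datum
  has these `K(2), K(3)`" DECIDES RH at dimension `2`.
* §3 `exists_sTwoThree_witness`: for every other `q ≥ 2` an RH-true `(a, b)` has an RH-FALSE partner: `q = 2`:
  `(-1, -1) ~ (5, 11)`; `5 ≤ q ≤ 49`: `(-k, q - 3k - 6) ~ (-(k+6), q + 3k + 12)` for a tabulated `k ≤ 7`
  (`sTwoThree_kTable`, `decide`); `q ≥ 50`: `(0, q - 6f²) ~ (6f, q + 12f²)` with `2f² ≤ q < 3f²`
  (`exists_f_window`, induction from `q = 50`).  Hence `traceReader_two_three_not_decides`.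
* §4 `traceReader_two_three_decides_iff` (`q ≥ 2`): a `{2, 3}`-trace-local reader deciding RH at dimension `2`
  EXISTS IF AND ONLY IF `q = 3 ∨ q = 4`.

DOOR READING ((i).G at `g = 2`, PROVED).  Whether a sparse lag set decides RH can DEPEND ON THE FIELD SIZE: `{2, 3}`
decides over `F_3` and `F_4` and over no other `F_q` — the first `q`-dependent entry of the lag-set table (part 7b:
`F ⊆ [0, g]` never depends on `q`; parts 8a/9a: strides, `{1, 3, 4}`, `{1, 4}` do not either).  The mechanism is
arithmetic, not analytic: the conic `(2a' + a)² = 9a² - 24b + 24q` has an integral point outside the box exactly when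
`q ∉ {3, 4}`.  Nothing here is, or implies, a statement about `ζ`.
-/

set_option linter.dupNamespace false

noncomputable section

open Polynomial Finset

open Summit.RiemannHypothesis.RiemannHypothesis.Theorems.PfPersistence.FfAngleTwin

namespace Summit.RiemannHypothesis.RiemannHypothesis.Theorems.MotivicDoor.FunctionField

/-- The honest quartic `x^4 + a x^3 + b x^2 + q a x + q^2` over `q` (local notation, no definition; as in part 9a). -/
local notation "quart[" q ", " a ", " b "]" =>
  (X ^ 4 + C (a : ℤ) * X ^ 3 + C (b : ℤ) * X ^ 2 + C (((q : ℕ) : ℤ) * (a : ℤ)) * X + C (((q : ℕ) : ℤ) ^ 2) : ℤ[X])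

/-- The RH box of [MN02, Lemma 2.1 (iii)] in integers (local notation, no definition; as in part 9a). -/
local notation "box[" q ", " a ", " b "]" =>
  ((0 : ℤ) ≤ (a : ℤ) ^ 2 - 4 * (b : ℤ) + 8 * ((q : ℕ) : ℤ) ∧ (a : ℤ) ^ 2 ≤ 16 * ((q : ℕ) : ℤ) ∧
    (0 : ℤ) ≤ 2 * ((q : ℕ) : ℤ) + (b : ℤ) ∧ 4 * (a : ℤ) ^ 2 * ((q : ℕ) : ℤ) ≤ (2 * ((q : ℕ) : ℤ) + (b : ℤ)) ^ 2)

/-! ## 1. The `(s_2, s_3)`-fibre is a conic -/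

/-- COLLISIONS OF `(s_2, s_3)`: if `(a', b')` and `(a, b)` give the same `s_2 = a² - 2b` and `s_3 = -a³ + 3ab - 3qa`,
then `2b' = a'² - a² + 2b` and either `a' = a` or `(2a' + a)² = 9a² - 24b + 24q`
(`(a' - a)(a'² + a a' - 2a² + 6b - 6q) = 0`). [folklore] -/
theorem sTwoThree_collision {q : ℕ} {a b a' b' : ℤ} (E2 : a' ^ 2 - 2 * b' = a ^ 2 - 2 * b)
    (E3 : -a' ^ 3 + 3 * a' * b' - 3 * q * a' = -a ^ 3 + 3 * a * b - 3 * q * a) :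
    2 * b' = a' ^ 2 - a ^ 2 + 2 * b ∧ (a' = a ∨ (2 * a' + a) ^ 2 = 9 * a ^ 2 - 24 * b + 24 * q) := by
  have hb : 2 * b' = a' ^ 2 - a ^ 2 + 2 * b := by linear_combination -E2
  refine ⟨hb, ?_⟩
  have key : (a' - a) * ((2 * a' + a) ^ 2 - (9 * a ^ 2 - 24 * b + 24 * q)) = 0 := by
    linear_combination 8 * E3 + (12 * a') * E2
  rcases mul_eq_zero.1 key with h | h
  · left; linarith
  · right; linarith

/-! ## 2. `q ∈ {3, 4}`: every partner of an RH-true pair is RH-true, so `{2, 3}` decides -/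

/-- THE DECIDING READER, GIVEN THE FINITE CHECK.  For `1 ≤ q ≤ 4`: IF every conic partner `a'` (`|a'| ≤ 19`) of every
RH-true `(a, b)` (necessarily `|a| ≤ 8`, `-8 ≤ b ≤ 24`) with integral `b' = (a'² - a² + 2b)/2` lies in the box, THEN
the `{2, 3}`-trace-local reader "some RH-true honest datum of dimension `2` over `q` has these `K(2), K(3)`" DECIDES
RH at dimension `2`.  (The bounds: `a² ≤ 16q ≤ 64`, `-2q ≤ b ≤ (a² + 8q)/4`, `(2a' + a)² ≤ 864 < 30²`.) [folklore] -/
theorem traceReader_two_three_decides_of_check {q : ℕ} (hq : 0 < q) (hq4 : q ≤ 4)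
    (hkey : ∀ a ∈ Icc (-8 : ℤ) 8, ∀ b ∈ Icc (-8 : ℤ) 24, box[q, a, b] →
      ∀ a' ∈ Icc (-19 : ℤ) 19, (2 * a' + a) * (2 * a' + a) = 9 * a * a - 24 * b + 24 * (q : ℤ) →
        (a' * a' - a * a + 2 * b) % 2 = 0 → box[q, a', (a' * a' - a * a + 2 * b) / 2]) :
    ∃ Φ : Tower → Prop,
      (∀ T T' : Tower, (∀ n ∈ ({2, 3} : Set ℕ), T n 0 (Fin.last n) = T' n 0 (Fin.last n)) → Φ T → Φ T') ∧
      ∀ h : ℤ[X], h.Monic → h.natDegree = 2 * 2 →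
        (∀ i j, i + j = 2 * 2 → (q : ℤ) ^ 2 * h.coeff j = (q : ℤ) ^ i * h.coeff i) →
        (Φ (weilWindowTower (q : ℝ) h) ↔ ∀ α ∈ frobRoots h, ‖α‖ = Real.sqrt q) := by
  have hqR : (0 : ℝ) < q := by exact_mod_cast hq
  have hqZ : (q : ℤ) ≤ 4 := by exact_mod_cast hq4
  have hq0 : (0 : ℤ) ≤ q := by positivity
  refine ⟨fun T => ∃ a b : ℤ, box[q, a, b] ∧
      ∀ n ∈ ({2, 3} : Set ℕ), T n 0 (Fin.last n) = weilWindowTower (q : ℝ) quart[q, a, b] n 0 (Fin.last n),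
    ?_, ?_⟩
  · rintro T T' hTT' ⟨a, b, hbox, htr⟩
    exact ⟨a, b, hbox, fun n hn => (hTT' n hn).symm.trans (htr n hn)⟩
  · intro h hh hdeg hFE
    obtain ⟨a', b', rfl⟩ : ∃ a' b' : ℤ, h = quart[q, a', b'] := ⟨_, _, eq_quartic_of_honest hq hh hdeg hFE⟩
    constructor
    · rintro ⟨a, b, hbox, htr⟩
      obtain ⟨-, s2, s3, -⟩ := powerSum_quartic q a' b'
      obtain ⟨-, t2, t3, -⟩ := powerSum_quartic q a b
      have e2 := (corner_eq_iff_powerSum_eq hqR _ _ 2).1 (htr 2 (by simp))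
      have e3 := (corner_eq_iff_powerSum_eq hqR _ _ 3).1 (htr 3 (by simp))
      rw [s2, t2] at e2
      rw [s3, t3] at e3
      have E2 : (a' ^ 2 - 2 * b' : ℤ) = a ^ 2 - 2 * b := by exact_mod_cast e2
      have E3 : (-a' ^ 3 + 3 * a' * b' - 3 * q * a' : ℤ) = -a ^ 3 + 3 * a * b - 3 * q * a := by
        exact_mod_cast e3
      refine (ffRH_quartic_iff hq a' b').2 ?_
      obtain ⟨hb', ha' | hD⟩ := sTwoThree_collision E2 E3
      · subst ha'
        obtain rfl : b' = b := by linarith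
        exact hbox
      · obtain ⟨i1, i2, i3, i4⟩ := hbox
        have ha_hi : a ≤ 8 := by nlinarith
        have ha_lo : -8 ≤ a := by nlinarith
        have hb_hi : b ≤ 24 := by linarith
        have hb_lo : -8 ≤ b := by linarith
        have hX_hi : 2 * a' + a ≤ 29 := by nlinarith
        have hX_lo : -29 ≤ 2 * a' + a := by nlinarith
        have hN : a' * a' - a * a + 2 * b = 2 * b' := by linear_combination -hb'
        have key := hkey a (mem_Icc.2 ⟨ha_lo, ha_hi⟩) b (mem_Icc.2 ⟨hb_lo, hb_hi⟩) ⟨i1, i2, i3, i4⟩ a'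
          (mem_Icc.2 ⟨by omega, by omega⟩) (by linear_combination hD) (by rw [hN]; omega)
        rw [hN, show (2 * b') / 2 = b' by omega] at key
        exact key
    · intro hR
      exact ⟨a', b', (ffRH_quartic_iff hq a' b').1 hR, fun n _ => rfl⟩

/-- THE FINITE CHECK AT `q = 3` (kernel `decide`; `561` pairs `(a, b)`, `63` of them RH-true, `21` integral partners,
all in the box). [folklore] -/
theorem sTwoThree_check_three : ∀ a ∈ Icc (-8 : ℤ) 8, ∀ b ∈ Icc (-8 : ℤ) 24, box[3, a, b] →
    ∀ a' ∈ Icc (-19 : ℤ) 19, (2 * a' + a) * (2 * a' + a) = 9 * a * a - 24 * b + 24 * ((3 : ℕ) : ℤ) →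
      (a' * a' - a * a + 2 * b) % 2 = 0 → box[3, a', (a' * a' - a * a + 2 * b) / 2] := by
  decide +kernel

/-- THE FINITE CHECK AT `q = 4` (kernel `decide`; `101` RH-true pairs, `23` integral partners, all in the box).
[folklore] -/
theorem sTwoThree_check_four : ∀ a ∈ Icc (-8 : ℤ) 8, ∀ b ∈ Icc (-8 : ℤ) 24, box[4, a, b] →
    ∀ a' ∈ Icc (-19 : ℤ) 19, (2 * a' + a) * (2 * a' + a) = 9 * a * a - 24 * b + 24 * ((4 : ℕ) : ℤ) →
      (a' * a' - a * a + 2 * b) % 2 = 0 → box[4, a', (a' * a' - a * a + 2 * b) / 2] := by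
  decide +kernel

/-! ## 3. `q ∉ {3, 4}`: an RH-true pair with an RH-false partner -/

/-- THE `k`-FAMILY OF WITNESSES: `(a, b) = (-k, q - 3k - 6)` and `(a', b') = (-(k + 6), q + 3k + 12)` share `s_2`
and `s_3` identically; the first is RH-true and the second RH-false (its fourth box inequality fails) as soon as
`k + 2 ≤ q`, `k² ≤ 16q`, `4k²q ≤ 9(q - k - 2)²` and `9(q + k + 4)² < 4(k + 6)²q`. [folklore] -/
theorem sTwoThree_witness_of_k {q k : ℕ} (h1 : k + 2 ≤ q) (h2 : k * k ≤ 16 * q)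
    (h3 : 4 * k * k * q + 18 * q * k + 36 * q ≤ 9 * q * q + 9 * k * k + 36 * k + 36)
    (h4 : 9 * (q + k + 4) * (q + k + 4) < 4 * (k + 6) * (k + 6) * q) :
    ∃ a b a' b' : ℤ, box[q, a, b] ∧ ¬ box[q, a', b'] ∧
      a' ^ 2 - 2 * b' = a ^ 2 - 2 * b ∧ -a' ^ 3 + 3 * a' * b' - 3 * q * a' = -a ^ 3 + 3 * a * b - 3 * q * a := by
  have h1' : (k : ℤ) + 2 ≤ q := by exact_mod_cast h1
  have h2' : (k : ℤ) * k ≤ 16 * q := by exact_mod_cast h2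
  have h3' : 4 * (k : ℤ) * k * q + 18 * q * k + 36 * q ≤ 9 * (q : ℤ) * q + 9 * k * k + 36 * k + 36 := by
    exact_mod_cast h3
  have h4' : 9 * ((q : ℤ) + k + 4) * (q + k + 4) < 4 * ((k : ℤ) + 6) * (k + 6) * q := by exact_mod_cast h4
  have hk0 : (0 : ℤ) ≤ k := by positivity
  have hq0 : (0 : ℤ) ≤ q := by positivity
  refine ⟨-(k : ℤ), (q : ℤ) - 3 * k - 6, -((k : ℤ) + 6), (q : ℤ) + 3 * k + 12, ⟨?_, ?_, ?_, ?_⟩, ?_, by ring,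
    by ring⟩
  · nlinarith
  · nlinarith
  · nlinarith
  · nlinarith
  · rintro ⟨-, -, -, h⟩
    nlinarith

/-- THE TABLE FOR `5 ≤ q ≤ 49` (kernel `decide`): some `k ≤ 7` satisfies the four inequalities of the `k`-family
(`k = 1` on `[5, 8]`, `2` on `[9, 13]`, `3` on `[14, 19]`, `4` on `[20, 25]`, `5` on `[26, 33]`, `6` on `[34, 41]`,
`7` on `[42, 49]`). [folklore] -/
theorem sTwoThree_kTable : ∀ q ∈ Icc 5 49, ∃ k ∈ range 8, k + 2 ≤ q ∧ k * k ≤ 16 * q ∧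
    4 * k * k * q + 18 * q * k + 36 * q ≤ 9 * q * q + 9 * k * k + 36 * k + 36 ∧
    9 * (q + k + 4) * (q + k + 4) < 4 * (k + 6) * (k + 6) * q := by
  decide +kernel

/-- THE `f`-FAMILY OF WITNESSES (large `q`): `(a, b) = (0, q - 6f²)` is RH-true and `(a', b') = (6f, q + 12f²)` is
RH-false (its first box inequality reads `4q - 12f² ≥ 0`) whenever `2f² ≤ q < 3f²`; they share `s_2 = 12f² - 2q` and
`s_3 = 0`. [folklore] -/
theorem sTwoThree_witness_of_f {q f : ℕ} (h1 : 2 * f * f ≤ q) (h2 : q < 3 * f * f) :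
    ∃ a b a' b' : ℤ, box[q, a, b] ∧ ¬ box[q, a', b'] ∧
      a' ^ 2 - 2 * b' = a ^ 2 - 2 * b ∧ -a' ^ 3 + 3 * a' * b' - 3 * q * a' = -a ^ 3 + 3 * a * b - 3 * q * a := by
  have h1' : 2 * (f : ℤ) * f ≤ q := by exact_mod_cast h1
  have h2' : (q : ℤ) < 3 * f * f := by exact_mod_cast h2
  have hf0 : (0 : ℤ) ≤ f := by positivity
  have hq0 : (0 : ℤ) ≤ q := by positivity
  refine ⟨0, (q : ℤ) - 6 * f * f, 6 * f, (q : ℤ) + 12 * f * f, ⟨?_, ?_, ?_, ?_⟩, ?_, by ring, by ring⟩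
  · nlinarith
  · nlinarith
  · nlinarith
  · nlinarith [sq_nonneg (2 * (q : ℤ) + ((q : ℤ) - 6 * f * f))]
  · rintro ⟨h, -, -, -⟩
    nlinarith

/-- THE WINDOWS `[2f², 3f²)` COVER `[50, ∞)` (induction from `q = 50`, `f = 5`; consecutive windows overlap since
`2(f + 1)² ≤ 3f²` for `f ≥ 5`). [folklore] -/
theorem exists_f_window {q : ℕ} (hq : 50 ≤ q) : ∃ f : ℕ, 5 ≤ f ∧ 2 * f * f ≤ q ∧ q < 3 * f * f := by
  induction q, hq using Nat.le_induction with
  | base => exact ⟨5, le_rfl, by norm_num, by norm_num⟩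
  | succ n hn ih =>
    obtain ⟨f, hf5, h1, h2⟩ := ih
    by_cases h : n + 1 < 3 * f * f
    · exact ⟨f, hf5, by omega, h⟩
    · refine ⟨f + 1, by omega, ?_, ?_⟩
      · have : n + 1 = 3 * f * f := by omega
        nlinarith
      · nlinarith

/-- WITNESSES FOR EVERY `q ≥ 2` OUTSIDE `{3, 4}`: an RH-true honest quartic and an RH-FALSE one with the same `s_2` and
`s_3` (`q = 2`: `(a, b) = (-1, -1)` vs `(5, 11)`; `5 ≤ q ≤ 49`: the `k`-family; `q ≥ 50`: the `f`-family). [folklore] -/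
theorem exists_sTwoThree_witness {q : ℕ} (hq : 2 ≤ q) (h3 : q ≠ 3) (h4 : q ≠ 4) :
    ∃ a b a' b' : ℤ, box[q, a, b] ∧ ¬ box[q, a', b'] ∧
      a' ^ 2 - 2 * b' = a ^ 2 - 2 * b ∧ -a' ^ 3 + 3 * a' * b' - 3 * q * a' = -a ^ 3 + 3 * a * b - 3 * q * a := by
  rcases Nat.lt_or_ge q 5 with hlt | h5
  · obtain rfl : q = 2 := by omega
    exact ⟨-1, -1, 5, 11, by norm_num, by norm_num, by norm_num, by norm_num⟩
  rcases Nat.lt_or_ge q 50 with hlt | h50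
  · obtain ⟨k, -, hk1, hk2, hk3, hk4⟩ := sTwoThree_kTable q (mem_Icc.2 ⟨h5, by omega⟩)
    exact sTwoThree_witness_of_k hk1 hk2 hk3 hk4
  · obtain ⟨f, -, hf1, hf2⟩ := exists_f_window h50
    exact sTwoThree_witness_of_f hf1 hf2

/-- `{2, 3}` DOES NOT DECIDE at dimension `2` for `q ≥ 2`, `q ∉ {3, 4}`: the witness pair of `exists_sTwoThree_witness`
is a pair of honest data with equal `K(2), K(3)`, one RH-true and one RH-false. [folklore] -/
theorem traceReader_two_three_not_decides {q : ℕ} (hq : 2 ≤ q) (h3 : q ≠ 3) (h4 : q ≠ 4) :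
    ¬ ∃ Φ : Tower → Prop,
      (∀ T T' : Tower, (∀ n ∈ ({2, 3} : Set ℕ), T n 0 (Fin.last n) = T' n 0 (Fin.last n)) → Φ T → Φ T') ∧
      ∀ h : ℤ[X], h.Monic → h.natDegree = 2 * 2 →
        (∀ i j, i + j = 2 * 2 → (q : ℤ) ^ 2 * h.coeff j = (q : ℤ) ^ i * h.coeff i) →
        (Φ (weilWindowTower (q : ℝ) h) ↔ ∀ α ∈ frobRoots h, ‖α‖ = Real.sqrt q) := by
  rintro ⟨Φ, hloc, hdec⟩
  have hq0 : 0 < q := by omega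
  have hqR : (0 : ℝ) < q := by exact_mod_cast hq0
  obtain ⟨a, b, a', b', hbox, hnbox, E2, E3⟩ := exists_sTwoThree_witness hq h3 h4
  obtain ⟨hm, hd, hfe⟩ := quartic_honest q a b
  obtain ⟨hm', hd', hfe'⟩ := quartic_honest q a' b'
  obtain ⟨-, s2, s3, -⟩ := powerSum_quartic q a b
  obtain ⟨-, t2, t3, -⟩ := powerSum_quartic q a' b'
  have hΦ := (hdec _ hm hd hfe).2 ((ffRH_quartic_iff hq0 a b).2 hbox)
  have hcorner : ∀ n ∈ ({2, 3} : Set ℕ), weilWindowTower (q : ℝ) quart[q, a, b] n 0 (Fin.last n) =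
      weilWindowTower (q : ℝ) quart[q, a', b'] n 0 (Fin.last n) := by
    intro n hn
    rcases (show n = 2 ∨ n = 3 by simpa using hn) with rfl | rfl
    · exact (corner_eq_iff_powerSum_eq hqR _ _ 2).2 (by rw [s2, t2]; exact_mod_cast E2.symm)
    · exact (corner_eq_iff_powerSum_eq hqR _ _ 3).2 (by rw [s3, t3]; exact_mod_cast E3.symm)
  have hR' := (hdec _ hm' hd' hfe').1 (hloc _ _ hcorner hΦ)
  exact hnbox ((ffRH_quartic_iff hq0 a' b').1 hR')

/-! ## 4. The pair `{2, 3}` decides at dimension 2 iff `q ∈ {3, 4}` -/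

/-- FF-DOOR (i).G at `g = 2`, A `q`-DEPENDENT LAG SET (`q ≥ 2`): a `{2, 3}`-trace-local reader DECIDING RH on the
honest data of dimension `2` over `q` EXISTS IF AND ONLY IF `q = 3` or `q = 4`.  (`⇐`: the finite kernel checks of §2;
`⇒`: the witness pairs of §3.)  Contrast: `F ⊆ [0, 2]` decides iff `F ⊇ {1, 2}` (part 7b), strides `{N, 2N}` always
decide (part 8a), `{1, 3, 4}` always and `{1, 4}` never (part 9a) — all independently of `q`. [folklore] -/
theorem traceReader_two_three_decides_iff {q : ℕ} (hq : 2 ≤ q) :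
    (∃ Φ : Tower → Prop,
      (∀ T T' : Tower, (∀ n ∈ ({2, 3} : Set ℕ), T n 0 (Fin.last n) = T' n 0 (Fin.last n)) → Φ T → Φ T') ∧
      ∀ h : ℤ[X], h.Monic → h.natDegree = 2 * 2 →
        (∀ i j, i + j = 2 * 2 → (q : ℤ) ^ 2 * h.coeff j = (q : ℤ) ^ i * h.coeff i) →
        (Φ (weilWindowTower (q : ℝ) h) ↔ ∀ α ∈ frobRoots h, ‖α‖ = Real.sqrt q)) ↔
    (q = 3 ∨ q = 4) := by
  constructor
  · intro h
    by_contra hne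
    exact traceReader_two_three_not_decides hq (fun h3 => hne (Or.inl h3)) (fun h4 => hne (Or.inr h4)) h
  · rintro (rfl | rfl)
    · exact traceReader_two_three_decides_of_check (by norm_num) (by norm_num) sTwoThree_check_three
    · exact traceReader_two_three_decides_of_check (by norm_num) (by norm_num) sTwoThree_check_four

end Summit.RiemannHypothesis.RiemannHypothesis.Theorems.MotivicDoor.FunctionField

end
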